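/-
Copyright (c) 2026. All rights reserved.
Released under Apache 2.0 license as described in the file LICENSE.
Authors: abc-iut cell, seat abc-iut-L4-t9 (gen 3; block W2-B2, model of [AbsTopIII] Cor 3.7).
-/
import Literature.AnabelianGeometry.AbsoluteAnabelian.AbsTopIII.MLFLogFrobeniusFunctors
import Literature.AnabelianGeometry.AbsoluteAnabelian.AbsTopIII.BiAnabelianTelecoreIncompatibilityProofs
import Literature.AnabelianGeometry.AbsoluteAnabelian.AbsTopIII.BiAnabelianCoresProofs
import Literature.AnabelianGeometry.AbsoluteAnabelian.AbsTopIII.BiAnabelianObservableProofs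
import Literature.AnabelianGeometry.AbsoluteAnabelian.AbsTopIII.BiAnabelianDeltaFamilyProofs
import HarnessLib

/-!
# [AbsTopIII] Corollary 3.7 AT THE MODEL: the Lemma-3.4 obstruction holds for MLF-Galois pairs on `ℚ̄_p`,
# hence Cor 3.7 (i), (iii), (iv) [and (ii) for every lift datum] unconditionally for the model setting

S. Mochizuki, *Topics in absolute anabelian geometry III* [MochizukiAbsTopIII2015] (kurims manuscript
`paper:url-5493eb38cbb7`), Cor 3.7 pp. 86–88; Lemma 3.4 p. 74 ("`α^pf((𝒪^⊳_k̄)^pf) ⊄ (𝒪^×_k̄)^pf` [...] so an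
inclusion [...] would imply that `(𝒪^⊳_k̄)^pf ⊆ (𝒪^×_k̄)^pf`, a contradiction"); proof of Cor 3.6 (iv) p. 81
("by writing out explicitly the meaning of such an equality `ζ'₁ = ζ₂`, we conclude that we obtain a
contradiction to Lemma 3.4"), to which the proof of Cor 3.7 (iv) p. 88 refers ("entirely similar").

Proof-only capstone of block W2-B2 (abc-iut-L4-t9).  The abstract-setting discharges of Cor 3.7 in the
tree (`cor_3_7_i_holds`, abc-iut-L4-t12's `cor_3_7_ii_holds`, `cor_3_7_iii_holds`,
`cor_3_7_iv_of_obstruction`) left ONE hypothesis for (iv): `BiAnabelianSetting.LogKernelObstruction` — "at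
some object `x₀` of `𝒳`, no isomorphism `a : x₀ ⥲ log x₀` has `λ^×(a) ≫ ι_{log,x₀} = ι_{×,x₀}`".  For the
MODEL setting `TFModel.modelSetting p` (`MLFLogFrobeniusFunctors.lean`: model MLF-Galois `TF`-pairs of
residue characteristic `p` on `ℚ̄_p`, Galois-isomorphisms, the real `log_{ℚ̄_p}`, `λ^×`, `λ^{×pf}`, `ι_log`,
`ι_×`) this hypothesis is now a THEOREM (`modelSetting_logKernelObstruction`): at the mono-analytic
object `(G_{ℚ_p} ↷ ℚ̄_p)`, for EVERY morphism `a`, the map `λ^×(a) ≫ ι_log` sends `p ∈ k̄^×` into the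
image of `(𝒪^×_k̄)^pf`, whereas `ι_×(p) = [p]` is not there (`‖p‖ < 1`; `iotaLogMap_ne_timesToPf_prime`).
Consequences, all with the tree's typed statements as (fully-qualified) types:

* `model_incompatibleStmt` — **Cor 3.7 (iv), first incompatibility, UNCONDITIONAL at the model**;
* `model_cor_3_7_iv θ` — Cor 3.7 (iv) (both incompatibilities) for every bi-anabelian lift datum `θ`
  of the model; `model_cor_3_7_ii θ` likewise (abc-iut-L4-t12's discharge specialised);
* `model_cor_3_7_i`, `model_cor_3_7_iii` — the core and observable statements at the model
  (specialisations of the every-setting discharges).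

HONEST FRAMING: the model has no "strictly Belyi type" condition and fixes `k̄ = ℚ̄_p` (residue
characteristic `p` component); the lift datum `θ^bi` of (ii)/(iv)/(v) ("arises from [...] Corollary
1.10") is NOT constructed here (it does not exist for general `Π_k ↠ G_k`, e.g. mono-analytic pairs —
that is the point of the `sB` hypothesis), so the `θ`-statements are proved "for every `θ`"; (v) stays
with abc-iut-L4-t12's `cor_3_7_v_of_lift` (needs id-rigidity of `𝒳`).  Refereed pre-IUT material;
nothing here bears on [IUTchIII] Cor. 3.12; typed ≠ discharged except for the theorems of this file.
-/

set_option autoImplicit false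

noncomputable section

namespace Literature.AnabelianGeometry.AbsoluteAnabelian.AbsTopIII

open CategoryTheory Literature.NumberTheory.Transcendental

/-! ## Change of log-coordinates does not affect the obstruction -/

namespace BiAnabelianSetting

universe u

variable {X E N : Type u} [Category.{u} X] [Category.{u} E] [Category.{u} N] (𝔖 : BiAnabelianSetting X E N)

/-- **Change of log-coordinates.** Replace the log-Frobenius functor of a setting by an ISOMORPHIC
endofunctor `log'` (`e : log' ≅ log`), transporting `logIsoId` and `ι_log` along `e` ("`log_{TF,TF}` is
isomorphic to the identity functor", Def 3.1 (iv) p. 69: any two choices of `log_{TF,TF}` within its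
isomorphism class are related this way). [cite: MochizukiAbsTopIII2015, Definition 3.1 (iv) p.69] -/
def rebaseLog (log' : X ⥤ X) (e : log' ≅ 𝔖.log) : BiAnabelianSetting X E N :=
  { 𝔖 with
    log := log'
    logIsoId := e ≪≫ 𝔖.logIsoId
    iotaLog := Functor.whiskerRight e.hom 𝔖.lamTimes ≫ 𝔖.iotaLog }

/-- `ι_log` of the rebased setting at `x`: `λ^×(e_x) ≫ ι_{log,x}`. [cite: MochizukiAbsTopIII2015, Definition 3.1 (iv) p.69] -/
theorem rebaseLog_iotaLog_app (log' : X ⥤ X) (e : log' ≅ 𝔖.log) (x : X) :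
    (𝔖.rebaseLog log' e).iotaLog.app x = 𝔖.lamTimes.map (e.hom.app x) ≫ 𝔖.iotaLog.app x := rfl

/-- **The Lemma-3.4 obstruction is invariant under change of log-coordinates**: for `e : log' ≅ log`,
`LogKernelObstruction` holds for the setting iff it holds for the rebased setting (isomorphisms
`x₀ ⥲ log x₀` and `x₀ ⥲ log' x₀` correspond under composition with `e_{x₀}`).  In particular the choice
`log_{TF,TF} = 𝟭` ("log-coordinates") in the model setting loses nothing.
[cite: MochizukiAbsTopIII2015, Cor 3.7 (iv) p.88] -/
theorem logKernelObstruction_rebaseLog_iff (log' : X ⥤ X) (e : log' ≅ 𝔖.log) :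
    (𝔖.rebaseLog log' e).LogKernelObstruction ↔ 𝔖.LogKernelObstruction := by
  have key : ∀ x₀ : X,
      (∀ a : x₀ ⟶ log'.obj x₀, IsIso a →
        𝔖.lamTimes.map a ≫ (𝔖.lamTimes.map (e.hom.app x₀) ≫ 𝔖.iotaLog.app x₀) ≠ 𝔖.iotaTimes.app x₀) ↔
      (∀ a : x₀ ⟶ 𝔖.log.obj x₀, IsIso a →
        𝔖.lamTimes.map a ≫ 𝔖.iotaLog.app x₀ ≠ 𝔖.iotaTimes.app x₀) := by
    intro x₀
    set ι : 𝔖.lamTimes.obj (𝔖.log.obj x₀) ⟶ 𝔖.lamTimesPf.obj x₀ := 𝔖.iotaLog.app x₀ with hι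
    constructor
    · intro h a ha hEq
      haveI := ha
      refine h (a ≫ e.inv.app x₀) inferInstance ?_
      rw [Functor.map_comp, Category.assoc, ← 𝔖.lamTimes.map_comp_assoc (e.inv.app x₀) (e.hom.app x₀),
        Iso.inv_hom_id_app, CategoryTheory.Functor.map_id, Category.id_comp]
      exact hEq
    · intro h a ha hEq
      haveI := ha
      refine h (a ≫ e.hom.app x₀) inferInstance ?_
      rw [Functor.map_comp, Category.assoc]
      exact hEq
  exact ⟨fun ⟨x₀, h⟩ => ⟨x₀, (key x₀).1 h⟩, fun ⟨x₀, h⟩ => ⟨x₀, (key x₀).2 h⟩⟩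

end BiAnabelianSetting

namespace TFModel

variable (p : ℕ) [hp : Fact p.Prime]

/-- The **mono-analytic** model object over `k` (Def 3.1 (ii): "if [...] the surjection `Π_k ↠ G_k` is an
isomorphism, then we shall refer to the MLF-Galois `T`-pair `(Π ↷ M)` as being of mono-analytic type"):
`Π_k := G_k = Gal(ℚ̄_p/k)`, `ε_k = id`. [cite: MochizukiAbsTopIII2015, Definition 3.1 (ii) p.67] -/
def monoAnalytic (k : IntermediateField ℚ_[p] (PadicAlgCl p)) [FiniteDimensional ℚ_[p] k] : TFModel p where
  k := k
  D := { Pi := PadicAlgCl p ≃ₐ[k] PadicAlgCl p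
         aug := MonoidHom.id _
         continuous_aug := continuous_id
         aug_surjective := Function.surjective_id }

/-- **The Lemma-3.4 obstruction HOLDS for the model setting** (at `x₀ = (G_{ℚ_p} ↷ ℚ̄_p)`, and in fact
for every morphism `a : x₀ → log x₀`, isomorphism or not): `(λ^×(a) ≫ ι_{log,x₀})(p) ∈ (𝒪^×_k̄)^pf` but
`ι_{×,x₀}(p) = [p] ∉ (𝒪^×_k̄)^pf`. [cite: MochizukiAbsTopIII2015, Lemma 3.4 p.74] -/
theorem modelSetting_logKernelObstruction :
    Literature.AnabelianGeometry.AbsoluteAnabelian.AbsTopIII.BiAnabelianSetting.LogKernelObstruction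
      (TFModel.modelSetting p) := by
  refine ⟨monoAnalytic p ⊥, fun a _ h => ?_⟩
  have h1 : ((TFModel.modelSetting p).lamTimes.map a ≫
      (TFModel.modelSetting p).iotaLog.app (monoAnalytic p ⊥)).homM (primeTimes p) =
      ((TFModel.modelSetting p).iotaTimes.app (monoAnalytic p ⊥)).homM (primeTimes p) := by rw [h]
  exact iotaLogMap_ne_timesToPf_prime
    (unitsGal (Hom.galois (a : Hom (monoAnalytic p ⊥) (monoAnalytic p ⊥))) (primeTimes p)) h1

/-- The obstruction for the model setting in ANY log-coordinates: for every endofunctor `log'` of `𝒳`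
isomorphic to the identity ("`log_{TF,TF}` is isomorphic to the identity functor") with `ι_log`
transported accordingly. [cite: MochizukiAbsTopIII2015, Lemma 3.4 p.74] -/
theorem modelSetting_rebaseLog_logKernelObstruction (log' : TFModel p ⥤ TFModel p)
    (e : log' ≅ 𝟭 (TFModel p)) :
    Literature.AnabelianGeometry.AbsoluteAnabelian.AbsTopIII.BiAnabelianSetting.LogKernelObstruction
      ((TFModel.modelSetting p).rebaseLog log' e) :=
  ((TFModel.modelSetting p).logKernelObstruction_rebaseLog_iff log' e).2
    (modelSetting_logKernelObstruction p)

/-- **[AbsTopIII] Cor 3.7 (iv), first incompatibility, UNCONDITIONAL for the model setting**: "the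
diagram of categories `𝒟†_{≤2}` does not admit a structure of core on `𝒟†_{≤1}` which [...] is
compatible with [...] the observable `𝔖†_log`" — abc-iut-L4-t9's typed `IncompatibleStmt`, via
`incompatibleStmt_of_obstruction` and the model obstruction. [cite: MochizukiAbsTopIII2015, Cor 3.7 (iv) p.88] -/
theorem model_incompatibleStmt :
    Literature.AnabelianGeometry.AbsoluteAnabelian.AbsTopIII.BiAnabelianSetting.IncompatibleStmt
      (TFModel.modelSetting p) :=
  (TFModel.modelSetting p).incompatibleStmt_of_obstruction (modelSetting_logKernelObstruction p)

/-- **[AbsTopIII] Cor 3.7 (iv) (both incompatibilities) for the model setting**, for every bi-anabelian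
lift datum `θ^bi` of the model (`cor_3_7_iv_of_obstruction` + the model obstruction).
[cite: MochizukiAbsTopIII2015, Cor 3.7 (iv) p.88] -/
theorem model_cor_3_7_iv (θ : FiberSquare.BiAnabelianLift (TFModel.modelSetting p).gal) :
    Literature.AnabelianGeometry.AbsoluteAnabelian.AbsTopIII.BiAnabelianSetting.Cor_3_7_iv
      (TFModel.modelSetting p) θ :=
  (TFModel.modelSetting p).cor_3_7_iv_of_obstruction θ (modelSetting_logKernelObstruction p)

/-- **[AbsTopIII] Cor 3.7 (i) for the model setting** ("`𝔈` forms a core of `𝒟†`; the second factor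
`𝒳` forms a core of `𝒟‡_{≤1}`") — specialisation of the every-setting discharge `cor_3_7_i_holds`.
[cite: MochizukiAbsTopIII2015, Cor 3.7 (i) p.87] -/
theorem model_cor_3_7_i :
    Literature.AnabelianGeometry.AbsoluteAnabelian.AbsTopIII.BiAnabelianSetting.Cor_3_7_i
      (TFModel.modelSetting p) :=
  (TFModel.modelSetting p).cor_3_7_i_holds

/-- **[AbsTopIII] Cor 3.7 (ii) for the model setting**, for every bi-anabelian lift datum `θ^bi` of the
model (abc-iut-L4-t12's every-setting discharge `cor_3_7_ii_holds`). [cite: MochizukiAbsTopIII2015, Cor 3.7 (ii) p.87] -/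
theorem model_cor_3_7_ii (θ : FiberSquare.BiAnabelianLift (TFModel.modelSetting p).gal) :
    Literature.AnabelianGeometry.AbsoluteAnabelian.AbsTopIII.BiAnabelianSetting.Cor_3_7_ii
      (TFModel.modelSetting p) θ :=
  (TFModel.modelSetting p).cor_3_7_ii_holds θ

/-- **[AbsTopIII] Cor 3.7 (iii) for the model setting** ("`ι_{log,⋎}`, `ι_×` belong to a family of
homotopies [...] that determines [...] a structure of observable `𝔖†_log`") — specialisation of the
every-setting discharge `cor_3_7_iii_holds`. [cite: MochizukiAbsTopIII2015, Cor 3.7 (iii) p.88] -/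
theorem model_cor_3_7_iii :
    Literature.AnabelianGeometry.AbsoluteAnabelian.AbsTopIII.BiAnabelianSetting.Cor_3_7_iii
      (TFModel.modelSetting p) :=
  (TFModel.modelSetting p).cor_3_7_iii_holds

end TFModel

end Literature.AnabelianGeometry.AbsoluteAnabelian.AbsTopIII

end
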